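import Summits.Langlands.Langlands.Theorems.SoloInformedWittDigitNorm

/-!
# Digit bounds versus powers of `(p, [ϖ])`, critical digits, Frobenius (solo programme, s78)

For a digit norm `d` on a perfect domain `R` of characteristic `p` and `ϖ ∈ R` with `v(ϖ) = ϱ`:
`x ∈ (p, [ϖ])^M ↔ DigitLE d ϱ^M x` (the `p`-adic gauge of `W(R)` on the annulus `|[ϖ]| = |p|`
is computed digit by digit), every non-zero `x` has a critical digit for its exact threshold, and the
Frobenius raises the threshold at a critical digit to the `p`-th power.  Infrastructure for the injectivity of
the Frobenius of `A_max`. [folklore]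
-/

namespace Summit.Langlands.Langlands.Theorems.WittDigits

open WittVector NNReal

variable {p : ℕ} [hp : Fact p.Prime] {R : Type*} [CommRing R] [CharP R p] [PerfectRing R p] [IsDomain R]
variable {d : DigitNorm R}

/-! ## Multiplication by powers of `p` -/

section CharP

omit [PerfectRing R p] [IsDomain R]

/-- `DigitLE (t ϱ^j) (p^j x) ↔ DigitLE t x`. [folklore] -/
theorem digitLE_p_pow_mul_iff (t : ℝ≥0) (x : WittVector p R) (j : ℕ) :
    DigitLE d (t * d.rho ^ j) ((p : WittVector p R) ^ j * x) ↔ DigitLE d t x := by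
  induction j with
  | zero => rw [pow_zero, pow_zero, mul_one, one_mul]
  | succ j ih =>
    rw [show (p : WittVector p R) ^ (j + 1) * x = (p : WittVector p R) * ((p : WittVector p R) ^ j * x) by ring,
      digitLE_p_mul_iff, show t * d.rho ^ (j + 1) / d.rho = t * d.rho ^ j by
        rw [pow_succ, ← mul_assoc, mul_div_cancel_right₀ _ d.rho_pos.ne'], ih]

/-- `Crit (t ϱ^j) (p^j x) (k + j) ↔ Crit t x k`. [folklore] -/
theorem crit_p_pow_mul_iff (t : ℝ≥0) (x : WittVector p R) (k j : ℕ) :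
    Crit d (t * d.rho ^ j) ((p : WittVector p R) ^ j * x) (k + j) ↔ Crit d t x k := by
  induction j with
  | zero => rw [pow_zero, pow_zero, mul_one, one_mul, add_zero]
  | succ j ih =>
    rw [← add_assoc, show (p : WittVector p R) ^ (j + 1) * x = (p : WittVector p R) * ((p : WittVector p R) ^ j * x) by ring,
      crit_p_mul_succ_iff, show t * d.rho ^ (j + 1) / d.rho = t * d.rho ^ j by
        rw [pow_succ, ← mul_assoc, mul_div_cancel_right₀ _ d.rho_pos.ne'], ih]

end CharP

/-! ## Powers of `(p, [ϖ])` -/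

/-- `(p, [ϖ])^M ⊆ {DigitLE ϱ^M}` when `v(ϖ) ≤ ϱ`. [folklore] -/
theorem digitLE_of_mem_pow {ϖ : R} (hϖ : d.v ϖ ≤ d.rho) :
    ∀ (M : ℕ) {x : WittVector p R}, x ∈ Ideal.span {(p : WittVector p R), teichmuller p ϖ} ^ M → DigitLE d (d.rho ^ M) x := by
  intro M
  induction M with
  | zero => intro x _; rw [pow_zero]; exact digitLE_of_one_le le_rfl x
  | succ M ih =>
    intro x hx
    rw [pow_succ', Ideal.span_insert, Ideal.sup_mul, Submodule.mem_sup] at hx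
    obtain ⟨y, hy, z, hz, rfl⟩ := hx
    obtain ⟨a, ha, rfl⟩ := Ideal.mem_span_singleton_mul.1 hy
    obtain ⟨b, hb, rfl⟩ := Ideal.mem_span_singleton_mul.1 hz
    rw [← Ideal.span_insert] at ha hb
    have h1 : DigitLE d (d.rho ^ (M + 1)) ((p : WittVector p R) * a) :=
      (digitLE_p_mul_iff _ _).2 (by rw [pow_succ, mul_div_cancel_right₀ _ d.rho_pos.ne']; exact ih ha)
    have h2 : DigitLE d (d.rho ^ (M + 1)) (teichmuller p ϖ * b) := by
      have h := digitLE_teichmuller_mul hϖ (ih hb)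
      rwa [← pow_succ'] at h
    exact DigitLE.add (pow_pos d.rho_pos _) h1 h2

omit [IsDomain R] in
/-- `{DigitLE ϱ^M} ⊆ (p, [ϖ])^M` when `ϱ ≤ v(ϖ)` (peel off the digit `x₀`, which is divisible by `ϖ^M`,
and recurse on `dshift x`). [folklore] -/
theorem mem_pow_of_digitLE {ϖ : R} (hϖ : d.rho ≤ d.v ϖ) :
    ∀ (M : ℕ) {x : WittVector p R}, DigitLE d (d.rho ^ M) x → x ∈ Ideal.span {(p : WittVector p R), teichmuller p ϖ} ^ M := by
  intro M
  induction M with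
  | zero => intro x _; rw [pow_zero, Ideal.one_eq_top]; exact Submodule.mem_top
  | succ M ih =>
    intro x hx
    obtain ⟨h0, h'⟩ := (digitLE_iff_dshift _ x).1 hx
    have hdiv : ϖ ^ (M + 1) ∣ x.coeff 0 :=
      d.dvd_of_le (h0.trans (by rw [Valuation.map_pow]; exact pow_le_pow_left₀ zero_le hϖ _))
    obtain ⟨c, hc⟩ := hdiv
    rw [eq_teichmuller_add_mul_dshift x]
    refine add_mem ?_ ?_
    · rw [hc, map_mul, map_pow]
      exact Ideal.mul_mem_right _ _ (Ideal.pow_mem_pow (Ideal.subset_span (by simp)) _)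
    · rw [pow_succ']
      refine Ideal.mul_mem_mul (Ideal.subset_span (by simp)) (ih ?_)
      rwa [pow_succ, mul_div_cancel_right₀ _ d.rho_pos.ne'] at h'

/-- **`x ∈ (p, [ϖ])^M ↔ DigitLE ϱ^M x`** for `v(ϖ) = ϱ`. [folklore] -/
theorem mem_pow_iff_digitLE {ϖ : R} (hϖ : d.v ϖ = d.rho) (M : ℕ) (x : WittVector p R) :
    x ∈ Ideal.span {(p : WittVector p R), teichmuller p ϖ} ^ M ↔ DigitLE d (d.rho ^ M) x :=
  ⟨digitLE_of_mem_pow hϖ.le M, mem_pow_of_digitLE hϖ.ge M⟩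

/-! ## Existence of a critical digit -/

omit [CharP R p] [PerfectRing R p] [IsDomain R] in
/-- **Every non-zero Witt vector has a critical digit**: there are a threshold `t > 0` with `DigitLE t x` and a
position `K` with equality (`t = max_k (v(x_k) ϱ^{k p^k})^{1/p^k}`, attained since the terms tend to `0`). [folklore] -/
theorem exists_crit {x : WittVector p R} (hx : x ≠ 0) :
    ∃ (t : ℝ≥0) (K : ℕ), 0 < t ∧ DigitLE d t x ∧ Crit d t x K := by
  let q : ℕ → ℝ≥0 := fun k => d.v (x.coeff k) * d.rho ^ (k * p ^ k)
  let s : ℕ → ℝ≥0 := fun k => q k ^ (((p ^ k : ℕ) : ℝ)⁻¹)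
  have hsq : ∀ k, s k ^ p ^ k = q k := fun k => NNReal.rpow_inv_natCast_pow _ (pow_ne_zero k hp.out.ne_zero)
  have hsk : ∀ k, s k ≤ d.rho ^ k := fun k =>
    (pow_le_pow_iff_left₀ zero_le zero_le (pow_ne_zero k hp.out.ne_zero)).1 (by rw [hsq]; exact digit_le_rho_pow x k)
  obtain ⟨k₁, hk₁⟩ : ∃ k, x.coeff k ≠ 0 := by
    by_contra! h
    exact hx (WittVector.ext fun k => by rw [h k, zero_coeff])
  have hq₁ : 0 < q k₁ :=
    mul_pos (pos_iff_ne_zero.2 (mt (DigitNorm.v_eq_zero_iff _).1 hk₁)) (pow_pos d.rho_pos _)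
  have hs₁ : 0 < s k₁ := NNReal.rpow_pos hq₁
  obtain ⟨N, hN⟩ := _root_.exists_pow_lt_of_lt_one hs₁ d.rho_lt_one
  have hlt : ∀ k, N ≤ k → s k < s k₁ := fun k hk =>
    (hsk k).trans_lt ((pow_le_pow_of_le_one zero_le d.rho_lt_one.le hk).trans_lt hN)
  have hk₁N : k₁ < N := lt_of_not_ge fun h => lt_irrefl _ (hlt k₁ h)
  obtain ⟨K, -, hK⟩ := (Finset.range N).exists_max_image s ⟨k₁, Finset.mem_range.2 hk₁N⟩
  have hKs : ∀ k, s k ≤ s K := by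
    intro k
    rcases lt_or_ge k N with h | h
    · exact hK k (Finset.mem_range.2 h)
    · exact (hlt k h).le.trans (hK k₁ (Finset.mem_range.2 hk₁N))
  refine ⟨s K, K, hs₁.trans_le (hK k₁ (Finset.mem_range.2 hk₁N)), fun k => ?_, ?_⟩
  · show q k ≤ s K ^ p ^ k
    rw [← hsq k]
    exact pow_le_pow_left₀ zero_le (hKs k) _
  · show q K = s K ^ p ^ K
    rw [hsq]

/-- A critical threshold below `ϱ^M` is impossible for `x ∉ (p, [ϖ])^M`. [folklore] -/
theorem pow_lt_of_not_mem {ϖ : R} (hϖ : d.v ϖ = d.rho) {M : ℕ} {x : WittVector p R} {t : ℝ≥0}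
    (hx : x ∉ Ideal.span {(p : WittVector p R), teichmuller p ϖ} ^ M) (ht : DigitLE d t x) : d.rho ^ M < t :=
  lt_of_not_ge fun h => hx ((mem_pow_iff_digitLE hϖ M x).2 (ht.mono h))

/-! ## Frobenius at a critical digit -/

omit [PerfectRing R p] [IsDomain R] in
/-- **Frobenius bound at a critical digit**: if the digit `K` of `x` is critical for `t` and `φ(x)` satisfies
`DigitLE τ`, then `t^p ϱ^K ≤ τ ϱ^{pK}`, i.e. `t^p ≤ τ ϱ^{(p-1)K}` (`φ` raises digits to the `p`-th power). [folklore] -/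
theorem crit_frobenius_le {t τ : ℝ≥0} {x : WittVector p R} {K : ℕ} (hK : Crit d t x K) (hF : DigitLE d τ (frobenius x)) :
    t ^ p * d.rho ^ K ≤ τ * d.rho ^ (p * K) := by
  have h1 := hF K
  rw [coeff_frobenius_charP p x K, Valuation.map_pow] at h1
  unfold Crit at hK
  have key : (t ^ p * d.rho ^ K) ^ p ^ K ≤ (τ * d.rho ^ (p * K)) ^ p ^ K :=
    calc (t ^ p * d.rho ^ K) ^ p ^ K = (t ^ p ^ K) ^ p * d.rho ^ (K * p ^ K) := by
          rw [mul_pow, ← pow_mul, ← pow_mul, ← pow_mul, mul_comm p (p ^ K)]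
      _ = (d.v (x.coeff K) * d.rho ^ (K * p ^ K)) ^ p * d.rho ^ (K * p ^ K) := by rw [hK]
      _ = d.v (x.coeff K) ^ p * d.rho ^ (K * p ^ K) * d.rho ^ (K * p ^ K * p) := by
          rw [mul_pow, ← pow_mul, mul_right_comm]
      _ ≤ τ ^ p ^ K * d.rho ^ (K * p ^ K * p) := mul_le_mul_of_nonneg_right h1 zero_le
      _ = (τ * d.rho ^ (p * K)) ^ p ^ K := by
          rw [mul_pow, ← pow_mul, show p * K * p ^ K = K * p ^ K * p by ring]
  exact (pow_le_pow_iff_left₀ zero_le zero_le (pow_ne_zero K hp.out.ne_zero)).1 key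

/-! ## The digit engine: no Frobenius tower through a non-zero class -/

/-- **The digit engine.** Let `𝔞 = (p, [ϖ])` with `v(ϖ) = ϱ`.  If `a_{n+1} ≡ p^{δ_n} a_n (mod 𝔞^{n + D_{n+1}})` and
`φ(a_n) ∈ 𝔞^{n + D_n}` for all `n` (`D_{n+1} = D_n + δ_n`), then `a_n ∈ 𝔞^{n + D_n}` for every `n`: otherwise a critical
digit of `a_{n₀}` survives along the tower (leading-digit stability under `p^δ`-scaling and sub-critical corrections),
while the Frobenius bound at a critical digit forces its threshold `t₀` to satisfy `t₀^p ≤ ϱ^{n}` for all `n`. [folklore] -/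
theorem mem_pow_of_frobenius_tower {ϖ : R} (hϖ : d.v ϖ = d.rho) {a : ℕ → WittVector p R} {D δ : ℕ → ℕ}
    (hD : ∀ n, D (n + 1) = D n + δ n)
    (he : ∀ n, a (n + 1) - (p : WittVector p R) ^ δ n * a n ∈
      Ideal.span {(p : WittVector p R), teichmuller p ϖ} ^ (n + D (n + 1)))
    (hφ : ∀ n, frobenius (a n) ∈ Ideal.span {(p : WittVector p R), teichmuller p ϖ} ^ (n + D n)) (n₀ : ℕ) :
    a n₀ ∈ Ideal.span {(p : WittVector p R), teichmuller p ϖ} ^ (n₀ + D n₀) := by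
  by_contra h0
  have hρ : 0 < d.rho := d.rho_pos
  have hρ1 : d.rho ≤ 1 := d.rho_lt_one.le
  obtain ⟨Δ, hΔ0, hΔs⟩ : ∃ Δ : ℕ → ℕ, Δ 0 = 0 ∧ ∀ m, Δ (m + 1) = Δ m + δ (n₀ + m) :=
    ⟨fun m => ∑ i ∈ Finset.range m, δ (n₀ + i), Finset.sum_range_zero _, fun m => Finset.sum_range_succ _ _⟩
  have hDΔ : ∀ m, D (n₀ + m) = D n₀ + Δ m := by
    intro m
    induction m with
    | zero => simp only [Nat.add_zero, hΔ0]
    | succ m ih => rw [← add_assoc, hD, ih, hΔs, add_assoc]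
  -- the critical digit of `a n₀`
  have ha0 : a n₀ ≠ 0 := by rintro h; rw [h] at h0; exact h0 (Submodule.zero_mem _)
  obtain ⟨t₀, K, ht₀, hLE, hK⟩ := exists_crit (d := d) ha0
  have hρt : d.rho ^ (n₀ + D n₀) < t₀ := pow_lt_of_not_mem hϖ h0 hLE
  -- it survives along the tower
  have inv : ∀ m, DigitLE d (t₀ * d.rho ^ Δ m) (a (n₀ + m)) ∧ Crit d (t₀ * d.rho ^ Δ m) (a (n₀ + m)) (K + Δ m) := by
    intro m
    induction m with
    | zero => simp only [hΔ0, pow_zero, mul_one, Nat.add_zero]; exact ⟨hLE, hK⟩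
    | succ m ih =>
      have hpos : 0 < t₀ * d.rho ^ Δ m * d.rho ^ δ (n₀ + m) := mul_pos (mul_pos ht₀ (pow_pos hρ _)) (pow_pos hρ _)
      have h1 : DigitLE d (t₀ * d.rho ^ Δ m * d.rho ^ δ (n₀ + m)) ((p : WittVector p R) ^ δ (n₀ + m) * a (n₀ + m)) :=
        (digitLE_p_pow_mul_iff _ _ _).2 ih.1
      have h2 : Crit d (t₀ * d.rho ^ Δ m * d.rho ^ δ (n₀ + m)) ((p : WittVector p R) ^ δ (n₀ + m) * a (n₀ + m))
          (K + Δ m + δ (n₀ + m)) :=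
        (crit_p_pow_mul_iff _ _ _ _).2 ih.2
      have hlt : d.rho ^ (n₀ + m + D (n₀ + m + 1)) < t₀ * d.rho ^ Δ m * d.rho ^ δ (n₀ + m) :=
        calc d.rho ^ (n₀ + m + D (n₀ + m + 1))
            = d.rho ^ (n₀ + D n₀) * d.rho ^ m * (d.rho ^ Δ m * d.rho ^ δ (n₀ + m)) := by rw [hD, hDΔ]; ring
          _ ≤ d.rho ^ (n₀ + D n₀) * (d.rho ^ Δ m * d.rho ^ δ (n₀ + m)) :=
            mul_le_mul_of_nonneg_right (mul_le_of_le_one_right zero_le (pow_le_one₀ zero_le hρ1)) zero_le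
          _ < t₀ * (d.rho ^ Δ m * d.rho ^ δ (n₀ + m)) :=
            mul_lt_mul_of_pos_right hρt (mul_pos (pow_pos hρ _) (pow_pos hρ _))
          _ = t₀ * d.rho ^ Δ m * d.rho ^ δ (n₀ + m) := (mul_assoc _ _ _).symm
      have h3 : DigitLT d (t₀ * d.rho ^ Δ m * d.rho ^ δ (n₀ + m))
          (a (n₀ + m + 1) - (p : WittVector p R) ^ δ (n₀ + m) * a (n₀ + m)) :=
        ((mem_pow_iff_digitLE hϖ _ _).1 (he (n₀ + m))).lt_of_lt hlt
      have hsplit : a (n₀ + (m + 1)) = (p : WittVector p R) ^ δ (n₀ + m) * a (n₀ + m) +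
          (a (n₀ + m + 1) - (p : WittVector p R) ^ δ (n₀ + m) * a (n₀ + m)) := by
        rw [← add_assoc, add_sub_cancel]
      rw [hsplit, hΔs, pow_add, ← mul_assoc, ← add_assoc]
      exact ⟨h1.add hpos h3.le, (crit_add_iff hpos h1 h3 _).2 h2⟩
  -- Frobenius at the critical digit of level `n₀ + m`, `m` large
  obtain ⟨m, hm⟩ := _root_.exists_pow_lt_of_lt_one (pow_pos ht₀ p) d.rho_lt_one
  have hA := crit_frobenius_le (inv m).2 ((mem_pow_iff_digitLE hϖ _ _).1 (hφ (n₀ + m)))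
  rw [hDΔ] at hA
  have hsmall : d.rho ^ D n₀ * d.rho ^ (p * K) ≤ d.rho ^ K :=
    calc d.rho ^ D n₀ * d.rho ^ (p * K) ≤ 1 * d.rho ^ K :=
        mul_le_mul' (pow_le_one₀ zero_le hρ1) (pow_le_pow_of_le_one zero_le hρ1 (Nat.le_mul_of_pos_left K hp.out.pos))
      _ = d.rho ^ K := one_mul _
  have key : t₀ ^ p * (d.rho ^ (p * Δ m) * d.rho ^ (K + Δ m)) ≤
      d.rho ^ (n₀ + m) * (d.rho ^ (p * Δ m) * d.rho ^ (K + Δ m)) :=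
    calc t₀ ^ p * (d.rho ^ (p * Δ m) * d.rho ^ (K + Δ m))
        = (t₀ * d.rho ^ Δ m) ^ p * d.rho ^ (K + Δ m) := by ring
      _ ≤ d.rho ^ (n₀ + m + (D n₀ + Δ m)) * d.rho ^ (p * (K + Δ m)) := hA
      _ = d.rho ^ (n₀ + m) * (d.rho ^ (p * Δ m) * d.rho ^ Δ m) * (d.rho ^ D n₀ * d.rho ^ (p * K)) := by ring
      _ ≤ d.rho ^ (n₀ + m) * (d.rho ^ (p * Δ m) * d.rho ^ Δ m) * d.rho ^ K :=
        mul_le_mul_of_nonneg_left hsmall zero_le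
      _ = d.rho ^ (n₀ + m) * (d.rho ^ (p * Δ m) * d.rho ^ (K + Δ m)) := by ring
  have hfin : t₀ ^ p ≤ d.rho ^ (n₀ + m) := le_of_mul_le_mul_right key (mul_pos (pow_pos hρ _) (pow_pos hρ _))
  exact absurd hm (not_lt.2 (hfin.trans (pow_le_pow_of_le_one zero_le hρ1 (Nat.le_add_left m n₀))))

end Summit.Langlands.Langlands.Theorems.WittDigits
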